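import Summits.AtomisticToContinuum.Crystallization.Theorems.BraggSlacknessRigidityStrictCertificateEinsteinCavity
import Literature.MathematicalPhysics.StatisticalMechanics.LennardJonesSquaredDistance

/-!
# Crux `StrictCertificate` (stmt-AtomisticToContinuum-13167, route `BraggSlacknessRigidity`):
# necessary conditions on a witness, VII — the Bochner kernel is `C^{1,1}`-FLAT at the origin

Support file for the line `registered` (lead c4); nothing here closes the item.  For a witness
`⟨P, ρ, c, g, U, f⟩` (any three-cone split of `V = V_LJ` attaining the periodic configuration `P`):

* §1 one-variable calculus for `Ṽ(t) = t⁻⁶/12 − t⁻³/6` (`V(r) = Ṽ(r²)`, `lennardJones_eq_tildeV_sq`):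
  `Ṽ''` (`hasDerivAt_tildeV_deriv`), the bounds `|Ṽ''| ≤ L(m) = (7/2)m⁻⁸ + 2m⁻⁵` on `[m,∞)` and
  `|Ṽ'(t)| ≤ (t⁻⁷ + t⁻⁴)/2`, the Lipschitz bound for `Ṽ'` and the SECOND-ORDER TAYLOR BOUND
  `|Ṽ(t) − Ṽ(s) − Ṽ'(s)(t − s)| ≤ L(m)(t − s)²` (two mean value inequalities,
  `Convex.norm_image_sub_le_of_norm_hasDerivWithin_le`; no `iteratedDeriv`);
* `lennardJones_secondDiff_le` — the symmetric second difference of `V∘‖·‖` along a displacement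
  `u` with `‖u‖ ≤ ‖v‖/4`: `V(‖v+u‖) + V(‖v−u‖) − 2V(‖v‖) ≤ ‖u‖² (7281 ‖v‖⁻¹⁴ + 521 ‖v‖⁻⁸)`;
* §2 `two_mul_f_zero_sub_f_le_sq_mul_tsum` — summing over the cavity (`two_mul_f_zero_sub_f_norm_le`
  of the previous file; the `r⁻¹⁴`, `r⁻⁸` lattice sums converge, `PeriodicConfiguration.summable_inv_pow_dist`):
  **`2 (f 0 − f ‖u‖) ≤ ‖u‖² · Σ'_{y ≠ p₀} (7281 (dist p₀ y)⁻¹⁴ + 521 (dist p₀ y)⁻⁸)`** for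
  `0 < ‖u‖ ≤ ρ₁/4`, `ρ₁` the nearest-neighbour distance at the site `p₀`;
* `f_zero_sub_f_le_mul_sq` — hence **`0 ≤ f 0 − f r ≤ K · r²` for `0 ≤ r ≤ δ`** with explicit
  `K = K_P(p₀)`, `δ = ρ₁/4`: the kernel of every exact certificate is `C^{1,1}`-flat at its maximum.
  (Next file: by Fourier inversion and Fatou, `∫ ‖ξ‖² 𝓕F ≤ 3K/(2π²)` — a finite second moment.)
* `flat_of_clauses` — registered sub-goal, crux conjuncts 2–7 verbatim as hypotheses.

All `[folklore]`.
-/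

noncomputable section

namespace Summit.AtomisticToContinuum.Crystallization.Theorems.BraggSlacknessRigidityStrictCertificate

open Literature.MathematicalPhysics.StatisticalMechanics
open Summit.AtomisticToContinuum.Crystallization.Theorems.ExactCertificateNegative (IsSplit)
open Summit.AtomisticToContinuum.Crystallization.Theorems.ChargedEnergyGapNegative (E3)
open Summit.AtomisticToContinuum.Crystallization.Theorems.PhononSlackCertificatesNearFarGlueR
  (periodicInsertion_exists_pos_le_dist)
open scoped BigOperators RealInnerProductSpace

/-! ## One-variable calculus for `Ṽ(t) = t⁻⁶/12 − t⁻³/6` (`V_LJ(r) = Ṽ(r²)`) -/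

/-- `V_LJ(r) = Ṽ(r²)` with `Ṽ(t) = (1/12) t⁻⁶ − (1/6) t⁻³`. [folklore] -/
theorem lennardJones_eq_tildeV_sq (r : ℝ) :
    lennardJones r = (1 / 12) * (r ^ 2)⁻¹ ^ 6 - (1 / 6) * (r ^ 2)⁻¹ ^ 3 := by
  unfold lennardJones
  rw [inv_pow, inv_pow, inv_pow, inv_pow, ← pow_mul, ← pow_mul]

/-- The second derivative of `Ṽ`: `Ṽ''(t) = (7/2) t⁻⁸ − 2 t⁻⁵` (`t ≠ 0`). [folklore] -/
theorem hasDerivAt_tildeV_deriv {t : ℝ} (ht : t ≠ 0) :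
    HasDerivAt (fun t : ℝ => -(1 / 2) * t⁻¹ ^ 7 + (1 / 2) * t⁻¹ ^ 4)
      ((7 / 2) * t⁻¹ ^ 8 - 2 * t⁻¹ ^ 5) t := by
  have hinv : HasDerivAt (fun s : ℝ => s⁻¹) (-(t ^ 2)⁻¹) t := hasDerivAt_inv ht
  have h7 : HasDerivAt (fun y : ℝ => y⁻¹ ^ 7) (((7 : ℕ) : ℝ) * t⁻¹ ^ (7 - 1) * -(t ^ 2)⁻¹) t :=
    hinv.pow 7
  have h4 : HasDerivAt (fun y : ℝ => y⁻¹ ^ 4) (((4 : ℕ) : ℝ) * t⁻¹ ^ (4 - 1) * -(t ^ 2)⁻¹) t :=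
    hinv.pow 4
  have h : HasDerivAt (fun y : ℝ => -(1 / 2) * y⁻¹ ^ 7 + (1 / 2) * y⁻¹ ^ 4)
      (-(1 / 2) * (((7 : ℕ) : ℝ) * t⁻¹ ^ (7 - 1) * -(t ^ 2)⁻¹) +
        (1 / 2) * (((4 : ℕ) : ℝ) * t⁻¹ ^ (4 - 1) * -(t ^ 2)⁻¹)) t :=
    HasDerivAt.add (HasDerivAt.const_mul (-(1 / 2)) h7) (HasDerivAt.const_mul (1 / 2) h4)
  refine HasDerivAt.congr_deriv h ?_
  push_cast
  field_simp
  ring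

/-- Bound on `Ṽ''` from below the argument: `|Ṽ''(t)| ≤ (7/2) m⁻⁸ + 2 m⁻⁵` for `0 < m ≤ t`.
[folklore] -/
theorem abs_tildeV_deriv2_le {m t : ℝ} (hm : 0 < m) (hmt : m ≤ t) :
    |(7 / 2) * t⁻¹ ^ 8 - 2 * t⁻¹ ^ 5| ≤ (7 / 2) * m⁻¹ ^ 8 + 2 * m⁻¹ ^ 5 := by
  have ht : 0 < t := hm.trans_le hmt
  have h1 : t⁻¹ ≤ m⁻¹ := inv_anti₀ hm hmt
  have h0 : 0 ≤ t⁻¹ := inv_nonneg.2 ht.le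
  have h8 : t⁻¹ ^ 8 ≤ m⁻¹ ^ 8 := pow_le_pow_left₀ h0 h1 8
  have h5 : t⁻¹ ^ 5 ≤ m⁻¹ ^ 5 := pow_le_pow_left₀ h0 h1 5
  have h8' : 0 ≤ t⁻¹ ^ 8 := pow_nonneg h0 8
  have h5' : 0 ≤ t⁻¹ ^ 5 := pow_nonneg h0 5
  rw [abs_le]
  constructor <;> nlinarith

/-- Bound on `Ṽ'`: `|Ṽ'(t)| ≤ (1/2)(t⁻⁷ + t⁻⁴)` for `0 < t`. [folklore] -/
theorem abs_tildeV_deriv_le {t : ℝ} (ht : 0 < t) :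
    |-(1 / 2) * t⁻¹ ^ 7 + (1 / 2) * t⁻¹ ^ 4| ≤ (1 / 2) * (t⁻¹ ^ 7 + t⁻¹ ^ 4) := by
  have h0 : 0 ≤ t⁻¹ := inv_nonneg.2 ht.le
  have h7 : 0 ≤ t⁻¹ ^ 7 := pow_nonneg h0 7
  have h4 : 0 ≤ t⁻¹ ^ 4 := pow_nonneg h0 4
  rw [abs_le]
  constructor <;> nlinarith

/-- **Lipschitz bound for `Ṽ'` on `[m, ∞)`**: `|Ṽ'(τ) − Ṽ'(s)| ≤ L(m) |τ − s|` with
`L(m) = (7/2) m⁻⁸ + 2 m⁻⁵`, for `s, τ ≥ m > 0` (mean value inequality). [folklore] -/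
theorem abs_tildeV_deriv_sub_le {m s τ : ℝ} (hm : 0 < m) (hs : m ≤ s) (hτ : m ≤ τ) :
    |(-(1 / 2) * τ⁻¹ ^ 7 + (1 / 2) * τ⁻¹ ^ 4) - (-(1 / 2) * s⁻¹ ^ 7 + (1 / 2) * s⁻¹ ^ 4)| ≤
      ((7 / 2) * m⁻¹ ^ 8 + 2 * m⁻¹ ^ 5) * |τ - s| := by
  have key := Convex.norm_image_sub_le_of_norm_hasDerivWithin_le
    (f := fun t : ℝ => -(1 / 2) * t⁻¹ ^ 7 + (1 / 2) * t⁻¹ ^ 4)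
    (f' := fun t : ℝ => (7 / 2) * t⁻¹ ^ 8 - 2 * t⁻¹ ^ 5) (s := Set.Ici m)
    (C := (7 / 2) * m⁻¹ ^ 8 + 2 * m⁻¹ ^ 5)
    (fun t ht => (hasDerivAt_tildeV_deriv (hm.trans_le ht).ne').hasDerivWithinAt)
    (fun t ht => by
      rw [Real.norm_eq_abs]
      exact abs_tildeV_deriv2_le hm ht)
    (convex_Ici m) hs hτ
  rw [Real.norm_eq_abs, Real.norm_eq_abs] at key
  exact key

/-- **Second-order Taylor bound for `Ṽ` on `[m, ∞)`**:
`|Ṽ(t) − Ṽ(s) − Ṽ'(s)(t − s)| ≤ L(m) (t − s)²` for `s, t ≥ m > 0` (mean value inequality applied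
to `τ ↦ Ṽ(τ) − Ṽ'(s) τ` on the segment between `s` and `t`). [folklore] -/
theorem abs_tildeV_taylor_le {m s t : ℝ} (hm : 0 < m) (hs : m ≤ s) (ht : m ≤ t) :
    |((1 / 12) * t⁻¹ ^ 6 - (1 / 6) * t⁻¹ ^ 3) - ((1 / 12) * s⁻¹ ^ 6 - (1 / 6) * s⁻¹ ^ 3)
        - (-(1 / 2) * s⁻¹ ^ 7 + (1 / 2) * s⁻¹ ^ 4) * (t - s)| ≤
      ((7 / 2) * m⁻¹ ^ 8 + 2 * m⁻¹ ^ 5) * (t - s) ^ 2 := by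
  set L : ℝ := (7 / 2) * m⁻¹ ^ 8 + 2 * m⁻¹ ^ 5 with hL
  set d : ℝ := -(1 / 2) * s⁻¹ ^ 7 + (1 / 2) * s⁻¹ ^ 4 with hd
  -- the auxiliary function `G(τ) = Ṽ(τ) − Ṽ'(s) τ` on the segment `[[s, t]] ⊆ [m, ∞)`
  have hseg : Set.uIcc s t ⊆ Set.Ici m := by
    intro τ hτ
    rw [Set.mem_uIcc] at hτ
    rcases hτ with ⟨h1, -⟩ | ⟨h1, -⟩
    · exact hs.trans h1
    · exact ht.trans h1
  have key := Convex.norm_image_sub_le_of_norm_hasDerivWithin_le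
    (f := fun τ : ℝ => ((1 / 12) * τ⁻¹ ^ 6 - (1 / 6) * τ⁻¹ ^ 3) - d * τ)
    (f' := fun τ : ℝ => (-(1 / 2) * τ⁻¹ ^ 7 + (1 / 2) * τ⁻¹ ^ 4) - d) (s := Set.uIcc s t)
    (C := L * |t - s|)
    (fun τ hτ => by
      have hτ0 : τ ≠ 0 := (hm.trans_le (hseg hτ)).ne'
      exact ((hasDerivAt_lennardJonesSq hτ0).sub
        ((hasDerivAt_id τ).const_mul d |>.congr_deriv (by ring))).hasDerivWithinAt)
    (fun τ hτ => by
      rw [Real.norm_eq_abs]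
      have h1 := abs_tildeV_deriv_sub_le hm hs (hseg hτ)
      refine h1.trans (mul_le_mul_of_nonneg_left (Set.abs_sub_left_of_mem_uIcc hτ) ?_)
      positivity)
    (convex_uIcc s t) Set.left_mem_uIcc Set.right_mem_uIcc
  rw [Real.norm_eq_abs, Real.norm_eq_abs] at key
  have e1 : ((1 / 12) * t⁻¹ ^ 6 - (1 / 6) * t⁻¹ ^ 3 - d * t) - ((1 / 12) * s⁻¹ ^ 6 - (1 / 6) * s⁻¹ ^ 3 - d * s)
      = ((1 / 12) * t⁻¹ ^ 6 - (1 / 6) * t⁻¹ ^ 3) - ((1 / 12) * s⁻¹ ^ 6 - (1 / 6) * s⁻¹ ^ 3)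
        - d * (t - s) := by ring
  rw [e1] at key
  refine key.trans_eq ?_
  rw [mul_assoc, abs_mul_abs_self, sq]


/-- **Symmetric second difference of `V_LJ∘‖·‖` along a small displacement.**  For `v ≠ 0` and
`‖u‖ ≤ ‖v‖/4`:
`V(‖v + u‖) + V(‖v − u‖) − 2 V(‖v‖) ≤ ‖u‖² · (7281 (‖v‖²)⁻⁷ + 521 (‖v‖²)⁻⁴)`.
(`‖v ± u‖² = s ± A + B` with `s = ‖v‖²`, `A = 2⟪v,u⟫`, `B = ‖u‖²`; second-order Taylor bound for `Ṽ`
on `[s/2, ∞)`, `A² ≤ 4 s B`, `B ≤ s/16`.) [folklore] -/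
theorem lennardJones_secondDiff_le {v u : E3} (hv : v ≠ 0) (hu : ‖u‖ ≤ ‖v‖ / 4) :
    lennardJones ‖v + u‖ + lennardJones ‖v - u‖ - 2 * lennardJones ‖v‖ ≤
      ‖u‖ ^ 2 * (7281 * (‖v‖ ^ 2)⁻¹ ^ 7 + 521 * (‖v‖ ^ 2)⁻¹ ^ 4) := by
  set s : ℝ := ‖v‖ ^ 2 with hsdef
  set A : ℝ := 2 * ⟪v, u⟫ with hAdef
  set B : ℝ := ‖u‖ ^ 2 with hBdef
  have hvpos : 0 < ‖v‖ := norm_pos_iff.2 hv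
  have hs : 0 < s := by rw [hsdef]; positivity
  have hB0 : 0 ≤ B := by rw [hBdef]; positivity
  have hu0 : 0 ≤ ‖u‖ := norm_nonneg u
  -- squared norms
  have htp : ‖v + u‖ ^ 2 = s + A + B := by rw [hsdef, hAdef, hBdef, norm_add_sq_real]
  have htm : ‖v - u‖ ^ 2 = s - A + B := by rw [hsdef, hAdef, hBdef, norm_sub_sq_real]
  -- the Cauchy–Schwarz facts
  have hinner : |⟪v, u⟫| ≤ ‖v‖ * ‖u‖ := abs_real_inner_le_norm v u
  have hvu : ‖v‖ * ‖u‖ ≤ s / 4 := by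
    rw [hsdef]
    nlinarith [mul_le_mul_of_nonneg_left hu hvpos.le]
  have hA : |A| ≤ s / 2 := by
    rw [hAdef, abs_mul, abs_two]
    linarith
  have hA2 : A ^ 2 ≤ 4 * s * B := by
    have h1 : ⟪v, u⟫ ^ 2 ≤ (‖v‖ * ‖u‖) ^ 2 := by
      rw [← sq_abs]
      exact pow_le_pow_left₀ (abs_nonneg _) hinner 2
    rw [hAdef, hsdef, hBdef]
    nlinarith [h1]
  have hB : B ≤ s / 16 := by
    rw [hBdef, hsdef]
    nlinarith [mul_le_mul hu hu hu0 (by positivity : (0 : ℝ) ≤ ‖v‖ / 4)]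
  -- the arguments stay above `s/2`
  have hm : 0 < s / 2 := by linarith
  have hss : s / 2 ≤ s := by linarith
  have htp' : s / 2 ≤ s + A + B := by have := neg_abs_le A; linarith [abs_nonneg A]
  have htm' : s / 2 ≤ s - A + B := by have := le_abs_self A; linarith
  -- `V = Ṽ ∘ sq`
  rw [lennardJones_eq_tildeV_sq ‖v + u‖, lennardJones_eq_tildeV_sq ‖v - u‖,
    lennardJones_eq_tildeV_sq ‖v‖, htp, htm, ← hsdef]
  -- the two Taylor bounds, with `(s/2)⁻¹ = 2 s⁻¹`
  have hp := (abs_le.1 (abs_tildeV_taylor_le hm hss htp')).2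
  have hq := (abs_le.1 (abs_tildeV_taylor_le hm hss htm')).2
  have hd := abs_tildeV_deriv_le hs
  have hXs : s⁻¹ * s = 1 := inv_mul_cancel₀ hs.ne'
  have hX0 : 0 < s⁻¹ := inv_pos.2 hs
  rw [show (s / 2)⁻¹ = 2 * s⁻¹ by rw [inv_div, div_eq_mul_inv]] at hp hq
  have e1 : s + A + B - s = A + B := by ring
  have e2 : s - A + B - s = B - A := by ring
  rw [e1] at hp
  rw [e2] at hq
  -- make the atoms opaque
  clear_value s A B
  generalize hX : s⁻¹ = X at hp hq hd hXs hX0 ⊢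
  --名 the Taylor data
  set L : ℝ := (7 / 2) * (2 * X) ^ 8 + 2 * (2 * X) ^ 5 with hLdef
  set d : ℝ := -(1 / 2) * X ^ 7 + (1 / 2) * X ^ 4 with hddef
  have hL : L = 896 * X ^ 8 + 64 * X ^ 5 := by rw [hLdef]; ring
  have hL0 : 0 ≤ L := by rw [hL]; positivity
  -- quadratic terms
  have hquad : L * (A + B) ^ 2 + L * (B - A) ^ 2 ≤ L * ((65 / 8) * s * B) := by
    have h1 : (A + B) ^ 2 + (B - A) ^ 2 ≤ (65 / 8) * s * B := by
      have h2 : B * B ≤ B * (s / 16) := mul_le_mul_of_nonneg_left hB hB0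
      nlinarith [hA2, h2]
    have h3 := mul_le_mul_of_nonneg_left h1 hL0
    linarith [h3, show L * ((A + B) ^ 2 + (B - A) ^ 2) = L * (A + B) ^ 2 + L * (B - A) ^ 2 by ring]
  -- linear terms
  have hlin : d * (A + B) + d * (B - A) ≤ (X ^ 7 + X ^ 4) * B := by
    have h1 : d * (A + B) + d * (B - A) = 2 * (d * B) := by ring
    have h2 : d * B ≤ |d| * B := mul_le_mul_of_nonneg_right (le_abs_self d) hB0
    have h3 : |d| * B ≤ (1 / 2) * (X ^ 7 + X ^ 4) * B := mul_le_mul_of_nonneg_right hd hB0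
    linarith
  -- powers of `X` against `s`
  have hX8 : X ^ 8 * s = X ^ 7 := by
    calc X ^ 8 * s = X ^ 7 * (X * s) := by ring
      _ = X ^ 7 := by rw [hXs, mul_one]
  have hX5 : X ^ 5 * s = X ^ 4 := by
    calc X ^ 5 * s = X ^ 4 * (X * s) := by ring
      _ = X ^ 4 := by rw [hXs, mul_one]
  have hfin : L * ((65 / 8) * s * B) = (7280 * X ^ 7 + 520 * X ^ 4) * B := by
    rw [hL]
    have h1 : (896 * X ^ 8 + 64 * X ^ 5) * ((65 / 8) * s * B)
        = (65 / 8) * (896 * (X ^ 8 * s) + 64 * (X ^ 5 * s)) * B := by ring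
    rw [h1, hX8, hX5]
    ring
  have htarget : B * (7281 * X ^ 7 + 521 * X ^ 4)
      = (7280 * X ^ 7 + 520 * X ^ 4) * B + (X ^ 7 + X ^ 4) * B := by ring
  rw [htarget]
  have hsum : (1 / 12 * (s + A + B)⁻¹ ^ 6 - 1 / 6 * (s + A + B)⁻¹ ^ 3)
      + (1 / 12 * (s - A + B)⁻¹ ^ 6 - 1 / 6 * (s - A + B)⁻¹ ^ 3)
      - 2 * (1 / 12 * X ^ 6 - 1 / 6 * X ^ 3)
      ≤ (L * (A + B) ^ 2 + L * (B - A) ^ 2) + (d * (A + B) + d * (B - A)) := by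
    linarith [hp, hq]
  linarith [hsum, hquad, hlin, hfin]


/-! ## §2 Flatness of the kernel at the origin -/

/-- `((d²)⁻¹)⁷ = (d⁻¹)¹⁴` and `((d²)⁻¹)⁴ = (d⁻¹)⁸`. [folklore] -/
theorem inv_sq_pow_eq (d : ℝ) :
    (d ^ 2)⁻¹ ^ 7 = d⁻¹ ^ 14 ∧ (d ^ 2)⁻¹ ^ 4 = d⁻¹ ^ 8 := by
  constructor <;> rw [← inv_pow, ← pow_mul]

/-- **Summing the second differences over the cavity.**  For a witness, a site `p₀ ∈ P` with
nearest-neighbour distance `ρ₁ > 0` and a displacement `u ≠ 0` with `‖u‖ ≤ ρ₁/4`: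
`2 (f 0 − f ‖u‖) ≤ ‖u‖² · Σ'_{y ∈ P, y ≠ p₀} (7281 (dist p₀ y)⁻¹⁴ + 521 (dist p₀ y)⁻⁸)`.
[folklore] -/
theorem two_mul_f_zero_sub_f_le_sq_mul_tsum {P : PeriodicConfiguration 3} {ρ c : ℝ}
    {g U f : ℝ → ℝ} (h : IsSplit ρ c g U f) (hv : c + f 0 / 2 ≤ -(P.energyPerParticle lennardJones))
    {p₀ : E3} (hp₀ : p₀ ∈ P.points) {ρ₁ : ℝ} (hρ₁ : 0 < ρ₁)
    (hsep : ∀ q ∈ P.points, q ≠ p₀ → ρ₁ ≤ dist p₀ q) {u : E3} (hu0 : u ≠ 0) (hu : ‖u‖ ≤ ρ₁ / 4) :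
    2 * (f 0 - f ‖u‖) ≤ ‖u‖ ^ 2 * ∑' q : {q : E3 // q ∈ P.points ∧ q ≠ p₀},
      (7281 * (dist p₀ q.1)⁻¹ ^ 14 + 521 * (dist p₀ q.1)⁻¹ ^ 8) := by
  -- `p₀ ± u ∉ P`
  have hlt : ‖u‖ < ρ₁ := by linarith
  have hup : p₀ + u ∉ P.points :=
    not_mem_points_of_dist_lt P hsep (by rwa [dist_self_add_right]) (by simpa using hu0)
  have hum : p₀ - u ∉ P.points :=
    not_mem_points_of_dist_lt P hsep (by rwa [dist_self_sub_right]) (by simpa using hu0)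
  have h2 := two_mul_f_zero_sub_f_norm_le h hv hp₀ hup hum
  -- termwise bound
  have hterm : ∀ q : {q : E3 // q ∈ P.points ∧ q ≠ p₀},
      lennardJones (dist (p₀ + u) q.1) + lennardJones (dist (p₀ - u) q.1)
        - 2 * lennardJones (dist p₀ q.1) ≤
      ‖u‖ ^ 2 * (7281 * (dist p₀ q.1)⁻¹ ^ 14 + 521 * (dist p₀ q.1)⁻¹ ^ 8) := by
    intro q
    have hvq : p₀ - q.1 ≠ 0 := sub_ne_zero.2 fun heq => q.2.2 heq.symm
    have e1 : dist (p₀ + u) q.1 = ‖(p₀ - q.1) + u‖ := by rw [dist_eq_norm]; congr 1; abel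
    have e2 : dist (p₀ - u) q.1 = ‖(p₀ - q.1) - u‖ := by rw [dist_eq_norm]; congr 1; abel
    have e3 : dist p₀ q.1 = ‖p₀ - q.1‖ := dist_eq_norm _ _
    have hu' : ‖u‖ ≤ ‖p₀ - q.1‖ / 4 := by
      have h4 := hsep q.1 q.2.1 q.2.2
      rw [e3] at h4
      linarith
    have key := lennardJones_secondDiff_le hvq hu'
    rw [(inv_sq_pow_eq ‖p₀ - q.1‖).1, (inv_sq_pow_eq ‖p₀ - q.1‖).2] at key
    rw [e1, e2, e3]
    exact key
  -- summability of both sides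
  have hsL : Summable fun q : {q : E3 // q ∈ P.points ∧ q ≠ p₀} =>
      lennardJones (dist (p₀ + u) q.1) + lennardJones (dist (p₀ - u) q.1)
        - 2 * lennardJones (dist p₀ q.1) := by
    have hs1 := summable_lennardJones_cavity_excess P (p₀ := p₀) hup
    have hs2 := summable_lennardJones_cavity_excess P (p₀ := p₀) hum
    refine (hs1.add hs2).congr fun q => ?_
    ring
  have hs14 := P.summable_inv_pow_dist (n := 14) (by norm_num) p₀
  have hs8 := P.summable_inv_pow_dist (n := 8) (by norm_num) p₀
  have hsR : Summable fun q : {q : E3 // q ∈ P.points ∧ q ≠ p₀} =>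
      ‖u‖ ^ 2 * (7281 * (dist p₀ q.1)⁻¹ ^ 14 + 521 * (dist p₀ q.1)⁻¹ ^ 8) :=
    ((hs14.mul_left 7281).add (hs8.mul_left 521)).mul_left _
  have hle := hsL.tsum_le_tsum hterm hsR
  rw [tsum_mul_left] at hle
  exact h2.trans hle

/-- **THE KERNEL IS `C^{1,1}`-FLAT AT THE ORIGIN.**  For every witness `⟨P, ρ, c, g, U, f⟩` there are
explicit `K` and `δ > 0` with `0 ≤ f 0 − f r ≤ K · r²` for all `0 ≤ r ≤ δ` (`δ = ρ₁/4` for the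
nearest-neighbour distance `ρ₁` at any site `p₀`, `K = ½ Σ'_{y ≠ p₀} (7281 (dist p₀ y)⁻¹⁴ + 521 (dist p₀ y)⁻⁸)`;
the lower bound is `|f| ≤ f 0`, positive type). [folklore] -/
theorem f_zero_sub_f_le_mul_sq {P : PeriodicConfiguration 3} {ρ c : ℝ} {g U f : ℝ → ℝ}
    (h : IsSplit ρ c g U f) (hv : c + f 0 / 2 ≤ -(P.energyPerParticle lennardJones)) :
    ∃ K δ : ℝ, 0 < δ ∧ ∀ r : ℝ, 0 ≤ r → r ≤ δ → 0 ≤ f 0 - f r ∧ f 0 - f r ≤ K * r ^ 2 := by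
  obtain ⟨p₀, hp₀⟩ := P.points_nonempty
  obtain ⟨ρ₁, hρ₁, hsep⟩ := periodicInsertion_exists_pos_le_dist P hp₀
  refine ⟨(1 / 2) * ∑' q : {q : E3 // q ∈ P.points ∧ q ≠ p₀},
      (7281 * (dist p₀ q.1)⁻¹ ^ 14 + 521 * (dist p₀ q.1)⁻¹ ^ 8), ρ₁ / 4, by linarith,
    fun r hr0 hrδ => ⟨?_, ?_⟩⟩
  · have h1 := h.abs_f_le hr0
    exact sub_nonneg.2 ((le_abs_self _).trans h1)
  · rcases hr0.eq_or_lt with rfl | hrpos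
    · simp
    · -- the displacement `u = r • e₀`, `‖e₀‖ = 1`
      set u : E3 := r • EuclideanSpace.single (0 : Fin 3) (1 : ℝ) with hudef
      have hnu : ‖u‖ = r := by
        rw [hudef, norm_smul, PiLp.norm_single, norm_one, mul_one, Real.norm_of_nonneg hr0]
      have hu0 : u ≠ 0 := by
        rw [← norm_ne_zero_iff, hnu]
        exact hrpos.ne'
      have key := two_mul_f_zero_sub_f_le_sq_mul_tsum h hv hp₀ hρ₁
        (fun q hq hne => hsep q hq hne) hu0 (by rw [hnu]; exact hrδ)
      rw [hnu] at key
      linarith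

/-- **Registered sub-goal `flat_of_clauses`** (crux conjuncts 2–7 verbatim as hypotheses): the Bochner
kernel of every witness of `StrictCertificate` (indeed of `ExactCertificate`) is `C^{1,1}`-flat at the
origin: `0 ≤ f 0 − f r ≤ K r²` on some `[0, δ]`, `δ > 0`. [folklore] -/
theorem flat_of_clauses : ∀ (P : Literature.MathematicalPhysics.StatisticalMechanics.PeriodicConfiguration 3) (ρ c : ℝ) (g U f : ℝ → ℝ), (∀ r : ℝ, 0 < r → Literature.MathematicalPhysics.StatisticalMechanics.lennardJones r = g r + U r + f r) → (∀ r : ℝ, 0 < r → 0 ≤ U r) → (∀ r : ℝ, ρ ≤ r → g r = 0) → (∀ (n : ℕ) (y : Fin n → EuclideanSpace ℝ (Fin 3)) (w : Fin n → ℝ), 0 ≤ ∑ i, ∑ j, w i * w j * f (dist (y i) (y j))) → (∀ (N : ℕ) (x : Fin N → EuclideanSpace ℝ (Fin 3)), Function.Injective x → -(c * (N : ℝ)) ≤ Literature.MathematicalPhysics.StatisticalMechanics.interactionEnergy g x) → c + f 0 / 2 = -(P.energyPerParticle Literature.MathematicalPhysics.StatisticalMechanics.lennardJones) → ∃ K δ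 : ℝ, 0 < δ ∧ ∀ r : ℝ, 0 ≤ r → r ≤ δ → 0 ≤ f 0 - f r ∧ f 0 - f r ≤ K * r ^ 2 :=
  fun _P _ρ _c _g _U _f h1 h2 h3 h4 h5 h6 => f_zero_sub_f_le_mul_sq ⟨h1, h2, h3, h4, h5⟩ h6.le

end Summit.AtomisticToContinuum.Crystallization.Theorems.BraggSlacknessRigidityStrictCertificate

end
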